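import Literature.NumberTheory.DiophantineGeometry.SchurWeylPlethysmOrbitWeightsProofs
import Mathlib.LinearAlgebra.Matrix.Determinant.Basic
import Mathlib.LinearAlgebra.Matrix.NonsingularInverse
import Mathlib.LinearAlgebra.Dimension.Finite
import HarnessLib

/-!
# Evaluation-rank lower bound for orbit-closure multiplicities

Topic `Computability/AlgebraicComplexity` (geometric complexity theory); a proofs file in the
tree's vocabulary (`coordRep`, `orbitVanishingIdeal`, `orbitCoordRep`, `highestWeightSpace`,
`orbitMultiplicity` — files `OrbitCoordinateRing.lean`, `GLHighestWeight.lean`,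
`SchurWeylPlethysm.lean`). It is the SEMANTIC half of the Lean certificate checker of the GCT
multiplicity-obstruction engine (cell `pub-gct`, bundle papers/PneNP/gct-obstructions; honest
framing: rung-1 multiplicity-obstruction search for permanent versus determinant at small `(n, m)`,
no claim about VP ≠ VNP or P ≠ NP), independent of any certificate format.

**The principle** (Bürgisser–Ikenmeyer 2013 §4; Dörfler–Ikenmeyer–Panova 2020 §5: "our goal is to
find a nonzero vector in `HWV_λ(⊗^{dn} ℂ^m)` that does not vanish under the composition of both
surjections", with `mult_λ(W) = dim HWV_λ(W)`; Bürgisser–Landsberg–Manivel–Weyman 2011 §5.2):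
if `F₀, …, F_{r-1}` are highest-weight vectors of weight `χ` among the polynomial functions on
`Sym^m (k^σ)` (i.e. `B`-semi-invariants for the contragredient representation `coordRep σ k m`,
`B` the upper triangular Borel), and `q₀, …, q_{r-1}` are points of the orbit `GL σ k · f` such
that the `r × r` evaluation matrix `(F_i(q_j))` has nonzero determinant, then the classes of the
`F_i` in the coordinate ring `k[Δ_m[f]] = k[Sym^m] ⧸ I(GL · f)` are `r` linearly independent
highest-weight vectors of weight `χ`, whence

  `r ≤ orbitMultiplicity k f m χ = dim HWV_χ(k[Δ_m[f]])`.

No genericity of the points is needed for this LOWER bound, and no complete reducibility: it is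
linear algebra plus the `GL`-equivariance of the restriction map (`mkₐ_comp_coordRep`). The only
analytic input is that the highest-weight spaces of `k[Δ_m[f]]` are finite-dimensional for
`m ≠ 0` over an infinite field (tree: `finiteDimensional_highestWeightSpace_orbitCoordRep_holds`),
so that `Module.finrank` is not its junk value.

Contents: `mk_mem_highestWeightSpace_orbitCoordRep` (classes of semi-invariants are
semi-invariants), `linearIndependent_mk_of_det_eval_ne_zero` (nonzero evaluation determinant on the
orbit ⇒ independent classes), `le_orbitMultiplicity_of_det_eval_ne_zero` (the bound), and the
occurrence corollary `hasHighestWeight_orbitCoordRep_of_eval_ne_zero` (`r = 1`: one semi-invariant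
not vanishing at one point of the orbit). Points are taken ON THE ORBIT (`linSubstRep σ k g f`,
`g : GL σ k`); the variant with points of the orbit CLOSURE follows from
`mem_orbitClosure_iff_formCoeff_holds` and is not needed by the certificates (their points are
`g · f` with `det g ≠ 0`).

## References
* [BurgisserIkenmeyer2013] P. Bürgisser, C. Ikenmeyer, *Explicit lower bounds via geometric
  complexity theory*, STOC 2013 = arXiv:1210.8368, §4.
* [DorflerIkenmeyerPanova2020] J. Dörfler, C. Ikenmeyer, G. Panova, *On geometric complexity
  theory: multiplicity obstructions are stronger than occurrence obstructions*, SIAM J. Appl.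
  Algebra Geom. 4 (2020) = arXiv:1901.04576, §5 (proof of the computer-calculation proposition).
* [BLMW2011] P. Bürgisser, J. M. Landsberg, L. Manivel, J. Weyman, *An overview of mathematical
  issues arising in the geometric complexity theory approach to VP ≠ VNP*, SIAM J. Comput. 40
  (2011), §5.2.
-/

noncomputable section

open MvPolynomial

namespace Literature.Computability.AlgebraicComplexity

open _root_.Literature.NumberTheory.DiophantineGeometry

variable {σ k : Type*} [Fintype σ] [LinearOrder σ] [Field k]

/-- The class in `k[Δ_m[f]]` of a `B`-semi-invariant polynomial function of weight `χ` on `Sym^m`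
is a `B`-semi-invariant of weight `χ` for `orbitCoordRep f m` (the restriction map is
`GL`-equivariant, `mkₐ_comp_coordRep`). Dörfler–Ikenmeyer–Panova 2020 §5 (the surjections
`HWV_λ(ℂ[A]_d) ↠ HWV_λ(ℂ[X]_d)`). [cite: DorflerIkenmeyerPanova2020, §5] -/
theorem mk_mem_highestWeightSpace_orbitCoordRep (f : MvPolynomial σ k) (m : ℕ) {χ : Weight σ}
    {F : MvPolynomial (DegIdx σ m) k} (hF : F ∈ highestWeightSpace (coordRep σ k m) χ) :
    Ideal.Quotient.mkₐ k (orbitVanishingIdeal f m) F ∈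
      highestWeightSpace (orbitCoordRep f m) χ := by
  intro g hg
  rw [← map_smul, Ideal.Quotient.mkₐ_eq_mk, orbitCoordRep_apply, orbitCoordSubst_mk,
    ← coordRep_apply, hF g hg]

/-- **Nonzero evaluation determinant on the orbit ⇒ linearly independent classes.** If
`F : Fin r → k[Sym^m]` and `g : Fin r → GL σ k` are such that the matrix
`(F_i (g_j · f))_{i,j}` — entries `aeval (formCoeff m (g_j · f)) (F i)` — has nonzero
determinant, then the classes of the `F_i` in `k[Δ_m[f]] = k[Sym^m] ⧸ I(GL · f)` are linearly
independent: a vanishing combination lies in `I(GL · f)`, hence vanishes at every `g_j · f`, and a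
square matrix with nonzero determinant has no nonzero left kernel vector
(`Matrix.exists_vecMul_eq_zero_iff`). Dörfler–Ikenmeyer–Panova 2020 §5; Bürgisser–Ikenmeyer 2013
§4. [cite: DorflerIkenmeyerPanova2020, §5] -/
theorem linearIndependent_mk_of_det_eval_ne_zero (f : MvPolynomial σ k) (m : ℕ) {r : ℕ}
    (F : Fin r → MvPolynomial (DegIdx σ m) k) (g : Fin r → GL σ k)
    (hdet : (Matrix.of fun i j => aeval (formCoeff m (linSubstRep σ k (g j) f)) (F i)).det ≠ 0) :
    LinearIndependent k fun i => Ideal.Quotient.mkₐ k (orbitVanishingIdeal f m) (F i) := by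
  rw [Fintype.linearIndependent_iff]
  intro c hc
  -- the combination `∑ c_i F_i` lies in the vanishing ideal of the orbit
  have hmem : ∑ i, c i • F i ∈ orbitVanishingIdeal f m := by
    rw [← Ideal.Quotient.eq_zero_iff_mem, ← Ideal.Quotient.mkₐ_eq_mk k, map_sum]
    simpa only [map_smul] using hc
  -- hence `c ᵥ* M = 0`
  have hvec : Matrix.vecMul c
      (Matrix.of fun i j => aeval (formCoeff m (linSubstRep σ k (g j) f)) (F i)) = 0 := by
    funext j
    have h := (mem_orbitVanishingIdeal_iff.mp hmem) (g j)
    rw [map_sum] at h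
    simp only [map_smul, smul_eq_mul] at h
    simpa [Matrix.vecMul, dotProduct, Matrix.of_apply] using h
  by_contra hne
  obtain ⟨i, hi⟩ := not_forall.mp hne
  exact hdet (Matrix.exists_vecMul_eq_zero_iff.mp ⟨c, fun h0 => hi (congr_fun h0 i), hvec⟩)

/-- **Evaluation-rank lower bound for orbit-closure multiplicities.** Over an infinite field, for
`m ≠ 0`: if `F₀, …, F_{r-1}` are highest-weight vectors of weight `χ` in `k[Sym^m (k^σ)]`
(`highestWeightSpace (coordRep σ k m) χ`) and `g₀, …, g_{r-1} ∈ GL σ k` make the evaluation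
matrix `(F_i(g_j · f))` nonsingular, then `r ≤ orbitMultiplicity k f m χ` (the dimension of the
weight-`χ` highest-weight space of `k[Δ_m[f]]`, finite by
`finiteDimensional_highestWeightSpace_orbitCoordRep_holds`). This is the lower-bound half of every
multiplicity computation by explicit highest-weight vectors: Bürgisser–Ikenmeyer 2013 §4;
Dörfler–Ikenmeyer–Panova 2020 §5 (`mult_λ = dim HWV_λ`, restriction is a surjection of HWV
spaces, rank of the evaluations at points); BLMW 2011 §5.2. [cite: DorflerIkenmeyerPanova2020, §5] -/
theorem le_orbitMultiplicity_of_det_eval_ne_zero [Infinite k] {f : MvPolynomial σ k} {m : ℕ}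
    (hm : m ≠ 0) {χ : Weight σ} {r : ℕ} (F : Fin r → MvPolynomial (DegIdx σ m) k)
    (hF : ∀ i, F i ∈ highestWeightSpace (coordRep σ k m) χ) (g : Fin r → GL σ k)
    (hdet : (Matrix.of fun i j => aeval (formCoeff m (linSubstRep σ k (g j) f)) (F i)).det ≠ 0) :
    r ≤ orbitMultiplicity k f m χ := by
  haveI : FiniteDimensional k (highestWeightSpace (orbitCoordRep f m) χ) :=
    finiteDimensional_highestWeightSpace_orbitCoordRep_holds f hm χ
  -- the classes, as elements of the highest-weight space
  let w : Fin r → highestWeightSpace (orbitCoordRep f m) χ := fun i =>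
    ⟨Ideal.Quotient.mkₐ k (orbitVanishingIdeal f m) (F i),
      mk_mem_highestWeightSpace_orbitCoordRep f m (hF i)⟩
  have hw : LinearIndependent k w :=
    LinearIndependent.of_comp (Submodule.subtype _)
      (linearIndependent_mk_of_det_eval_ne_zero f m F g hdet)
  simpa only [orbitMultiplicity, hwMultiplicity, Fintype.card_fin] using hw.fintype_card_le_finrank

/-- **Occurrence from one nonzero evaluation** (`r = 1`): a highest-weight vector `F` of weight
`χ` in `k[Sym^m]` that does not vanish at one point `g · f` of the orbit witnesses that `V(χ)`
occurs in `k[Δ_m[f]]`, `HasHighestWeight (orbitCoordRep f m) χ` (any field; no finiteness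
needed). Dörfler–Ikenmeyer–Panova 2020 §5 ("the existence of a `π` and a `p` such that the
contraction is nonzero"). [cite: DorflerIkenmeyerPanova2020, §5] -/
theorem hasHighestWeight_orbitCoordRep_of_eval_ne_zero {f : MvPolynomial σ k} {m : ℕ}
    {χ : Weight σ} {F : MvPolynomial (DegIdx σ m) k}
    (hF : F ∈ highestWeightSpace (coordRep σ k m) χ) (g : GL σ k)
    (hne : aeval (formCoeff m (linSubstRep σ k g f)) F ≠ 0) :
    HasHighestWeight (orbitCoordRep f m) χ := by
  rw [hasHighestWeight_iff_exists]
  refine ⟨Ideal.Quotient.mkₐ k (orbitVanishingIdeal f m) F, ?_,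
    mk_mem_highestWeightSpace_orbitCoordRep f m hF⟩
  intro h0
  rw [Ideal.Quotient.mkₐ_eq_mk, Ideal.Quotient.eq_zero_iff_mem, mem_orbitVanishingIdeal_iff] at h0
  exact hne (h0 g)

/-! ### Points of the orbit closure (singular substitutions allowed) -/

/-- A polynomial function in the vanishing ideal of the orbit `GL · f` vanishes at every point of
the orbit CLOSURE `Δ[f]` (for `f` a nonzero form of degree `m`): the closure is the zero locus of
that ideal on `Sym^m` (tree: `mem_orbitClosure_iff_formCoeff_holds`). Mulmuley–Sohoni 2001 §4.
[cite: MulmuleySohoniSIAM2001, §4] -/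
theorem aeval_formCoeff_eq_zero_of_mem_orbitClosure {f q : MvPolynomial σ k} {m : ℕ}
    (hf : f.IsHomogeneous m) (hf0 : f ≠ 0) (hq : q ∈ orbitClosure f)
    {F : MvPolynomial (DegIdx σ m) k} (hF : F ∈ orbitVanishingIdeal f m) :
    aeval (formCoeff m q) F = 0 :=
  (MvPolynomial.mem_zeroLocus_iff.mp ((mem_orbitClosure_iff_formCoeff_holds hf hf0).mp hq).2) F hF

/-- **Nonzero evaluation determinant at points of the orbit closure ⇒ independent classes**
(variant of `linearIndependent_mk_of_det_eval_ne_zero` with arbitrary points `q_j ∈ Δ[f]`, e.g.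
`q_j = A_j · f` for possibly singular matrices `A_j` over an infinite field,
`endOrbit_subset_orbitClosure_holds`). Dörfler–Ikenmeyer–Panova 2020 §5. [cite: DorflerIkenmeyerPanova2020, §5] -/
theorem linearIndependent_mk_of_det_eval_ne_zero_of_mem_orbitClosure {f : MvPolynomial σ k}
    {m : ℕ} (hf : f.IsHomogeneous m) (hf0 : f ≠ 0) {r : ℕ} (F : Fin r → MvPolynomial (DegIdx σ m) k)
    (q : Fin r → MvPolynomial σ k) (hq : ∀ j, q j ∈ orbitClosure f)
    (hdet : (Matrix.of fun i j => aeval (formCoeff m (q j)) (F i)).det ≠ 0) :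
    LinearIndependent k fun i => Ideal.Quotient.mkₐ k (orbitVanishingIdeal f m) (F i) := by
  rw [Fintype.linearIndependent_iff]
  intro c hc
  have hmem : ∑ i, c i • F i ∈ orbitVanishingIdeal f m := by
    rw [← Ideal.Quotient.eq_zero_iff_mem, ← Ideal.Quotient.mkₐ_eq_mk k, map_sum]
    simpa only [map_smul] using hc
  have hvec : Matrix.vecMul c (Matrix.of fun i j => aeval (formCoeff m (q j)) (F i)) = 0 := by
    funext j
    have h := aeval_formCoeff_eq_zero_of_mem_orbitClosure hf hf0 (hq j) hmem
    rw [map_sum] at h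
    simp only [map_smul, smul_eq_mul] at h
    simpa [Matrix.vecMul, dotProduct, Matrix.of_apply] using h
  by_contra hne
  obtain ⟨i, hi⟩ := not_forall.mp hne
  exact hdet (Matrix.exists_vecMul_eq_zero_iff.mp ⟨c, fun h0 => hi (congr_fun h0 i), hvec⟩)

/-- **Evaluation-rank lower bound with points of the orbit closure.** Over an infinite field, for
a nonzero form `f` of degree `m ≠ 0`: `r` highest-weight vectors of weight `χ` in `k[Sym^m]` whose
evaluation matrix at `r` points of `Δ[f]` is nonsingular give `r ≤ orbitMultiplicity k f m χ`. With
`endOrbit_subset_orbitClosure_holds` the points may be `A_j · f` for ANY matrices `A_j` — the form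
used by the certificate checker (no invertibility check on the points). Bürgisser–Ikenmeyer 2013
§4; Dörfler–Ikenmeyer–Panova 2020 §5. [cite: DorflerIkenmeyerPanova2020, §5] -/
theorem le_orbitMultiplicity_of_det_eval_ne_zero_of_mem_orbitClosure [Infinite k]
    {f : MvPolynomial σ k} {m : ℕ} (hm : m ≠ 0) (hf : f.IsHomogeneous m) (hf0 : f ≠ 0)
    {χ : Weight σ} {r : ℕ} (F : Fin r → MvPolynomial (DegIdx σ m) k)
    (hF : ∀ i, F i ∈ highestWeightSpace (coordRep σ k m) χ)
    (q : Fin r → MvPolynomial σ k) (hq : ∀ j, q j ∈ orbitClosure f)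
    (hdet : (Matrix.of fun i j => aeval (formCoeff m (q j)) (F i)).det ≠ 0) :
    r ≤ orbitMultiplicity k f m χ := by
  haveI : FiniteDimensional k (highestWeightSpace (orbitCoordRep f m) χ) :=
    finiteDimensional_highestWeightSpace_orbitCoordRep_holds f hm χ
  let w : Fin r → highestWeightSpace (orbitCoordRep f m) χ := fun i =>
    ⟨Ideal.Quotient.mkₐ k (orbitVanishingIdeal f m) (F i),
      mk_mem_highestWeightSpace_orbitCoordRep f m (hF i)⟩
  have hw : LinearIndependent k w :=
    LinearIndependent.of_comp (Submodule.subtype _)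
      (linearIndependent_mk_of_det_eval_ne_zero_of_mem_orbitClosure hf hf0 F q hq hdet)
  simpa only [orbitMultiplicity, hwMultiplicity, Fintype.card_fin] using hw.fintype_card_le_finrank

/-- The substitution of ANY matrix into `f` is a point of the orbit closure (infinite field):
`A · f ∈ End · f ⊆ Δ[f]` (tree: `endOrbit_subset_orbitClosure_holds`). Mulmuley–Sohoni 2001 §4.
[cite: MulmuleySohoniSIAM2001, §4] -/
theorem linSubst_mem_orbitClosure [Infinite k] (f : MvPolynomial σ k) (A : Matrix σ σ k) :
    linSubst σ k A f ∈ orbitClosure f :=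
  endOrbit_subset_orbitClosure_holds f ⟨A, rfl⟩

end Literature.Computability.AlgebraicComplexity
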